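import Literature.MathematicalPhysics.QuantumFieldTheory.Balaban1983to89.B9Thm314GpFlatEntries
import Literature.MathematicalPhysics.QuantumFieldTheory.Balaban1983to89.B9Ineq346GpFlatMultiLevelTorus

/-!
# `Balaban1983to89.B9Thm314GpFlatL2` — [B9] THEOREM 3.14 (p.427, (3.154)) AT `U = 1` FOR `G′` ON THE GENUINE `k`-LEVEL
TORUS: THE FOUR `L²` MEMBERS (3.46) FOR THE DIFFERENCE OF TWO FAMILIES —
`‖1_{B(y)}(G′[D] − G′[D′])λ‖₂ ≤ C·L^{2k}·E·‖λ‖₂`, `‖1_{B(y)}∇_μ(…)λ‖₂, ‖1_{B(y)}(…)∇_μ*λ‖₂ ≤ C·L^k·E·‖λ‖₂`,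
`‖1_{B(y)}Δ(…)λ‖₂ ≤ C·E·‖λ‖₂` with `E = e^{−δ·min(d_D,d_{D′})(y,y′)}·e^{−δ·d(y,y′,Ω)}`, `supp λ ⊂ B(y′)`, common top
blocks `y, y′` (Schur's test on the sup members of files 3–4; no existing module is touched; no fact is minted)

FRAMING (verbatim cell line):
statement-level skeleton of published theorems with citation tags; proofs where landed; nothing here is a claim about the Yang–Mills mass gap

Sources under audit (cell pub-balaban / lit-balaban): T. Bałaban, *Propagators for lattice gauge theories in a
background field*, Commun. Math. Phys. **99** (1985) 389–434 [`Balaban1985BackgroundPropagators`, "B9"], pp. 426–427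
(Theorem 3.14: «their difference satisfies ALL the inequalities characteristic for operators of the considered type,
with the additional factor exp(−δ₀d(y, y′, Ω))»), p. 398 ((3.46), the `L²` members of Theorem 3.1).  Unit `lit-balaban-p21`
(Phase-2 proof seat p21 gen 18), HOME `run/shared/lean/pub/lit-balaban/`.  Inputs BY NAME: the sup package
`B9Thm314GpFlatEntries.thm314_Gp_sup_flat_multiLevelTorus` (files 3–4), the Schur lemmas
`B9Ineq346GpFlatMultiLevelTorus.row_abs_sum_le_of_bound`/`l2_block_sq_le_of_sums`/`vOp_mulVec_blockSupp`,
`gmlT_transpose`, `perLapT_isSymm`, `perLapT_eq_mlOpT_sub`, `gmlT_mul_mlOpT_pos`, file 3's `blockSupp_transfer`/`weights_repair`.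

## WHAT THIS FILE CERTIFIES (kernel-checked; lattice units; setting of files 1–7 `B9Thm314GpFlat…`)

* `dOmega_comm` — (3.154) is symmetric; `vOp_mulVec_eq_of_top` — `Q′*aQ′[D]μ = Q′*aQ′[D′]μ` for `μ` supported in a
  common top block; `transpose_lapGp` — `(ΔG′)ᵀ = 1 − G′Q′*aQ′` in one family.
* **`thm314_Gp_l2_flat_multiLevelTorus`** — `k`-uniform `δ, C, M₀, N₀` such that for all admissible data, two torus
  families `D, D′`, common TOP blocks `y = B^k(p)`, `y′ = B^k(q)` and `λ = 0` off `B^k(q)`: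
  `Σ_{x∈B^k(p)}(((G′[D] − G′[D′])λ)(x))² ≤ (C·L^{2k}·E)²·Σλ²`,
  `Σ_{x∈B^k(p)}((∇_μ(G′[D] − G′[D′])λ)(x))² ≤ (C·L^k·E)²·Σλ²`, `Σ_{x∈B^k(p)}(((G′[D] − G′[D′])∇_μ*λ)(x))² ≤ (C·L^k·E)²·Σλ²`,
  `Σ_{x∈B^k(p)}((Δ(G′[D] − G′[D′])λ)(x))² ≤ (C·E)²·Σλ²`
  with `E = e^{−δ·min(d_D(y,y′),d_{D′}(y,y′))}·e^{−δ·d(y,y′,Ω)}` — rows from the sup members at `(p,q)`, columns from the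
  sup members at `(q,p)` through `(G′[D] − G′[D′])ᵀ = G′[D] − G′[D′]`, `(∇_μ(…))ᵀ = (…)∇_μ*` and, for `Δ(…)`,
  `(Δ(G′[D] − G′[D′]))ᵀμ = −(G′[D] − G′[D′])Q′*aQ′μ` (`Q′*aQ′μ` the same in both families on a common top block, of
  size `a₊L^{−2k}`), symmetry of `d_T` and of `d(·,·,Ω)`.

## HONEST SCOPE

As files 3–7 (`U = 1`, `G′` only, torus lineage, (3.154) = file 1's `dOmega`, `min(d_D,d_{D′})`); the four `L²` members of
the difference (not (3.44)–(3.45)); `h` = indicator of one top block, `Δ` = the periodic Laplacian `perLapT`,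
inequalities squared, lattice units.  Nothing is inferred from the manuscript: every step is
kernel-checked.
-/

namespace Literature.MathematicalPhysics.QuantumFieldTheory.Balaban1983to89.B9Thm314GpFlatL2

open Finset Matrix
open Literature.MathematicalPhysics.QuantumFieldTheory.Balaban1983to89.B4Reflection242 (boxDom mem_boxDom blk)
open Literature.MathematicalPhysics.QuantumFieldTheory.Balaban1983to89.B6MultiLevelBoxOperator
open Literature.MathematicalPhysics.QuantumFieldTheory.Balaban1983to89.B6MultiLevelTorusOperator
open Literature.MathematicalPhysics.QuantumFieldTheory.Balaban1983to89.B6Geom246MultiLevelBox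
open Literature.MathematicalPhysics.QuantumFieldTheory.Balaban1983to89.B6Geom246MultiLevelTorus
open Literature.MathematicalPhysics.QuantumFieldTheory.Balaban1983to89.B8Ineq192MultiLevelTorus (symmT)
open Literature.MathematicalPhysics.QuantumFieldTheory.Balaban1983to89.B6Prop22DerivMultiLevelTorus (dT)
open Literature.MathematicalPhysics.QuantumFieldTheory.Balaban1983to89.B6Prop22AdjMultiLevelTorus (gmlT_transpose)
open Literature.MathematicalPhysics.QuantumFieldTheory.Balaban1983to89.B6RandomWalk (HasMajorant BlockSupp)
open Literature.MathematicalPhysics.QuantumFieldTheory.Balaban1983to89.B6Ineq243TwoLevelBox (aNext)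
open Literature.MathematicalPhysics.QuantumFieldTheory.Balaban1983to89.B9Thm314GpFlatTorusGeometry
open Literature.MathematicalPhysics.QuantumFieldTheory.Balaban1983to89.B9Thm314GpFlatEntries (thm314_Gp_sup_flat_multiLevelTorus)
open Literature.MathematicalPhysics.QuantumFieldTheory.Balaban1983to89.B6Prop22MultiLevelTorus (gmlT_mul_mlOpT_pos)
open Literature.MathematicalPhysics.QuantumFieldTheory.Balaban1983to89.B6Prop22LapMultiLevelBox (vOp vOp_apply)
open Literature.MathematicalPhysics.QuantumFieldTheory.Balaban1983to89.B6Prop22LapMultiLevelTorus (perLapT_eq_mlOpT_sub)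
open Literature.MathematicalPhysics.QuantumFieldTheory.Balaban1983to89.B9Thm314GpFlatResolvent (blkOf_eq_iff_blkOf_eq)
open Literature.MathematicalPhysics.QuantumFieldTheory.Balaban1983to89.B9Thm314GpFlatMultiLevelTorus (blockSupp_transfer
  weights_repair gmlT_congr)
open Literature.MathematicalPhysics.QuantumFieldTheory.Balaban1983to89.B9Ineq346GpFlatMultiLevelTorus (row_abs_sum_le_of_bound
  l2_block_sq_le_of_sums vOp_mulVec_blockSupp)

noncomputable section

variable {d : ℕ}

section Sym

variable {ℓ Mh k R : ℕ} {P : Fin (d + 1) → ℕ} (D D' : TDomains d ℓ Mh k P R)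

/-- **(3.154) IS SYMMETRIC**: `d(y,y′,Ω) = d(y′,y,Ω)`. [cite: Balaban1985BackgroundPropagators, (3.154) p.427] -/
theorem dOmega_comm (β β' : Fin (d + 1) → ℤ) : dOmega D D' β β' = dOmega D D' β' β := by
  unfold dOmega
  split_ifs with h
  · refine congrArg _ (funext fun β₁ => ?_)
    rw [add_comm]
    unfold tdistK
    rw [dist_comm (toT (N0 ℓ Mh k P) (cenLab ((ℓ + 1) ^ k) β₁)) (toT (N0 ℓ Mh k P) (cenLab ((ℓ + 1) ^ k) β')),
      dist_comm (toT (N0 ℓ Mh k P) (cenLab ((ℓ + 1) ^ k) β)) (toT (N0 ℓ Mh k P) (cenLab ((ℓ + 1) ^ k) β₁))]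
  · rfl

/-- column sums over a block are row sums of the transpose. [folklore] [cite: Balaban1985BackgroundPropagators, (3.46) p.398, dictionary] -/
theorem col_sum_eq_row_sum_transpose (T : Matrix ↥(boxDom (N0 ℓ Mh k P)) ↥(boxDom (N0 ℓ Mh k P)) ℝ)
    (y : ↥(bset D.toDomains)) (z : ↥(boxDom (N0 ℓ Mh k P))) :
    ∑ x ∈ Finset.univ.filter (fun x => blkOf D.toDomains x = y), |T x z|
      = ∑ x ∈ Finset.univ.filter (fun x => blkOf D.toDomains x = y), |Tᵀ z x| := by
  simp only [Matrix.transpose_apply]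

/-- **`Q′*aQ′[D]μ = Q′*aQ′[D′]μ` FOR `μ` SUPPORTED IN A COMMON TOP BLOCK** (both families have level `k` there and the
averaging cube is the block itself; off the block both vanish). [cite: Balaban1984PropagatorsII, (2.14) p.225, (2.1) p.224; Balaban1985BackgroundPropagators, Thm 3.14 p.427, dictionary] -/
theorem vOp_mulVec_eq_of_top {a : ℕ → ℝ} {aplus : ℝ} (ha0 : ∀ j, 1 ≤ j → 0 ≤ a j) (hap : ∀ j, 1 ≤ j → a j ≤ aplus)
    {p : ℕ × (Fin (d + 1) → ℤ)} (hpD : p ∈ bset D.toDomains) (hpD' : p ∈ bset D'.toDomains) (hp : p.1 = k)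
    {μ : ↥(boxDom (N0 ℓ Mh k P)) → ℝ} {B : ℝ} (hμ : BlockSupp (g := geomT D) (blkOf D.toDomains) μ ⟨p, hpD⟩ B) :
    vOp (N0 ℓ Mh k P) ℓ k D.lev a *ᵥ μ = vOp (N0 ℓ Mh k P) ℓ k D'.lev a *ᵥ μ := by
  have hμ' := blockSupp_transfer D D' hpD hpD' hμ
  funext z
  by_cases hz : blkOf D.toDomains z = ⟨p, hpD⟩
  · have hz' : blkOf D'.toDomains z = ⟨p, hpD'⟩ := (blkOf_eq_iff_blkOf_eq D D' hpD hpD' z).1 hz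
    have hl : D.lev z.1 = k := by
      have : (blkOf D.toDomains z).1.1 = k := by rw [hz]; exact hp
      exact this
    have hl' : D'.lev z.1 = k := by
      have : (blkOf D'.toDomains z).1.1 = k := by rw [hz']; exact hp
      exact this
    simp only [Matrix.mulVec, dotProduct]
    refine Finset.sum_congr rfl fun w _ => ?_
    have e1 := vOp_apply D.toDomains a z w
    have e2 := vOp_apply D'.toDomains a z w
    rw [TDomains.toDomains_lev] at e1 e2
    rw [e1, e2, hl, hl']
  · have hz' : ¬ blkOf D'.toDomains z = ⟨p, hpD'⟩ := fun h => hz ((blkOf_eq_iff_blkOf_eq D D' hpD hpD' z).2 h)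
    rw [(vOp_mulVec_blockSupp D ha0 hap hμ).off z hz, (vOp_mulVec_blockSupp D' ha0 hap hμ').off z hz']

/-- **`(ΔG′)ᵀ = G′Δ = 1 − G′Q′*aQ′`** for one torus family (periodic Laplacian; `G′ᵀ = G′`, `Δ′_aG′ = 1`).
[cite: Balaban1984PropagatorsII, (2.13)–(2.14) p.225, dictionary] -/
theorem transpose_lapGp (hMh : 1 ≤ Mh) (hP : ∀ μ, 1 ≤ P μ) {a : ℕ → ℝ} (ha1 : ∀ j, 1 ≤ j → 0 < a j) :
    (perLapT (N0 ℓ Mh k P) * gmlT (N0 ℓ Mh k P) ℓ k D.lev a)ᵀ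
      = 1 - gmlT (N0 ℓ Mh k P) ℓ k D.lev a * vOp (N0 ℓ Mh k P) ℓ k D.lev a := by
  rw [Matrix.transpose_mul, gmlT_transpose, (perLapT_isSymm (N := N0 ℓ Mh k P)).eq,
    perLapT_eq_mlOpT_sub (N0 ℓ Mh k P) ℓ k D.lev a, Matrix.mul_sub,
    gmlT_mul_mlOpT_pos (one_le_N0 hMh hP) D.one_le_lev D.lev_le ha1]

end Sym

/-- **[B9] THEOREM 3.14 AT `U = 1` FOR `G′`: THE `L²` MEMBERS (3.46) FOR THE DIFFERENCE** (the `G′`, `∇_μG′`, `G′∇_μ*`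
members and the `ΔG′` member, squared, one set of constants). [cite: Balaban1985BackgroundPropagators, Thm 3.14 (3.154) pp.426–427 with (3.46) p.398; Balaban1984PropagatorsII, Prop. 2.2 (2.67) p.234] -/
theorem thm314_Gp_l2_flat_multiLevelTorus (d ℓ : ℕ) (hℓ : 1 ≤ ℓ) (aminus aplus a2minus a2plus : ℝ) (ha : 0 < aminus)
    (ha2 : 0 < a2minus) :
    ∃ δ C M₀ : ℝ, ∃ N₀ : ℕ, 0 < δ ∧ 0 < C ∧ 0 < M₀ ∧ 0 < N₀ ∧
      ∀ (k Mh R : ℕ), 3 ≤ Mh → M₀ ≤ ((ℓ : ℝ) + 1) * Mh → 2 * (ℓ + 1) ≤ R → N₀ + 1 ≤ R * ((ℓ + 1) * Mh) →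
      ∀ (P : Fin (d + 1) → ℕ) (hP : ∀ μ, 1 ≤ P μ) (hP4 : ∀ μ, 4 ≤ P μ) (D D' : TDomains d ℓ Mh k P R)
        (a c : ℕ → ℝ), (∀ i, 1 ≤ i → aminus ≤ a i ∧ a i ≤ aplus) → (∀ i, 1 ≤ i → a2minus ≤ c i ∧ c i ≤ a2plus) →
        (∀ i, 1 ≤ i → a (i + 1) = aNext ℓ (a i) (c i)) →
      ∀ (p q : ℕ × (Fin (d + 1) → ℤ)) (hpD : p ∈ bset D.toDomains) (hpD' : p ∈ bset D'.toDomains)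
        (hqD : q ∈ bset D.toDomains) (hqD' : q ∈ bset D'.toDomains), p.1 = k → q.1 = k →
      ∀ (lam : ↥(boxDom (N0 ℓ Mh k P)) → ℝ), (∀ z, blkOf D.toDomains z ≠ ⟨q, hqD⟩ → lam z = 0) →
        ∑ x ∈ Finset.univ.filter (fun x => blkOf D.toDomains x = ⟨p, hpD⟩),
            (((gmlT (N0 ℓ Mh k P) ℓ k D.lev a - gmlT (N0 ℓ Mh k P) ℓ k D'.lev a) *ᵥ lam) x) ^ 2
          ≤ (C * ((ℓ : ℝ) + 1) ^ (2 * k)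
              * Real.exp (-(δ * min ((geomT D).dist ⟨p, hpD⟩ ⟨q, hqD⟩) ((geomT D').dist ⟨p, hpD'⟩ ⟨q, hqD'⟩)))
              * Real.exp (-(δ * dOmega D D' p.2 q.2))) ^ 2 * ∑ z, lam z ^ 2 ∧
        (∀ μ : Fin (d + 1),
          ∑ x ∈ Finset.univ.filter (fun x => blkOf D.toDomains x = ⟨p, hpD⟩),
            (((dT (N0 ℓ Mh k P) μ * gmlT (N0 ℓ Mh k P) ℓ k D.lev a - dT (N0 ℓ Mh k P) μ * gmlT (N0 ℓ Mh k P) ℓ k D'.lev a)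
                *ᵥ lam) x) ^ 2
          ≤ (C * ((ℓ : ℝ) + 1) ^ k
              * Real.exp (-(δ * min ((geomT D).dist ⟨p, hpD⟩ ⟨q, hqD⟩) ((geomT D').dist ⟨p, hpD'⟩ ⟨q, hqD'⟩)))
              * Real.exp (-(δ * dOmega D D' p.2 q.2))) ^ 2 * ∑ z, lam z ^ 2) ∧
        (∀ μ : Fin (d + 1),
          ∑ x ∈ Finset.univ.filter (fun x => blkOf D.toDomains x = ⟨p, hpD⟩),
            (((gmlT (N0 ℓ Mh k P) ℓ k D.lev a * (dT (N0 ℓ Mh k P) μ)ᵀ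
                - gmlT (N0 ℓ Mh k P) ℓ k D'.lev a * (dT (N0 ℓ Mh k P) μ)ᵀ) *ᵥ lam) x) ^ 2
          ≤ (C * ((ℓ : ℝ) + 1) ^ k
              * Real.exp (-(δ * min ((geomT D).dist ⟨p, hpD⟩ ⟨q, hqD⟩) ((geomT D').dist ⟨p, hpD'⟩ ⟨q, hqD'⟩)))
              * Real.exp (-(δ * dOmega D D' p.2 q.2))) ^ 2 * ∑ z, lam z ^ 2) ∧
        ∑ x ∈ Finset.univ.filter (fun x => blkOf D.toDomains x = ⟨p, hpD⟩),
            (((perLapT (N0 ℓ Mh k P) * gmlT (N0 ℓ Mh k P) ℓ k D.lev a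
                - perLapT (N0 ℓ Mh k P) * gmlT (N0 ℓ Mh k P) ℓ k D'.lev a) *ᵥ lam) x) ^ 2
          ≤ (C * Real.exp (-(δ * min ((geomT D).dist ⟨p, hpD⟩ ⟨q, hqD⟩) ((geomT D').dist ⟨p, hpD'⟩ ⟨q, hqD'⟩)))
              * Real.exp (-(δ * dOmega D D' p.2 q.2))) ^ 2 * ∑ z, lam z ^ 2 := by
  obtain ⟨δ, C₀, M₀, N₀, hδ, hC₀, hM₀, hN₀, h⟩ := thm314_Gp_sup_flat_multiLevelTorus d ℓ hℓ aminus aplus a2minus a2plus ha ha2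
  -- one constant for all four members: `C ≥ C₀`, `C² ≥ C₀²·max(a₊, a₋)` (the `ΔG′` columns carry the weight bound)
  have hap0 : 0 < max aplus aminus := lt_of_lt_of_le ha (le_max_right _ _)
  refine ⟨δ, C₀ * max 1 (max aplus aminus), M₀, N₀, hδ, by positivity, hM₀, hN₀, ?_⟩
  intro k Mh R hMh hM hR hRM P hP hP4 D D' a c haw hcw hac p q hpD hpD' hqD hqD' hp hq lam hlam
  have hMh1 : 1 ≤ Mh := le_trans (by norm_num) hMh
  have hC₀1 : C₀ ≤ C₀ * max 1 (max aplus aminus) := le_mul_of_one_le_right hC₀.le (le_max_left _ _)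
  set C := C₀ * max 1 (max aplus aminus) with hCdef
  have hC : 0 < C := by positivity
  have hpq := h k Mh R hMh hM hR hRM P hP hP4 D D' a c haw hcw hac p q hpD hpD' hqD hqD' hp hq
  have hqp := h k Mh R hMh hM hR hRM P hP hP4 D D' a c haw hcw hac q p hqD hqD' hpD hpD' hq hp
  -- the characteristic factor is symmetric in `(p, q)`
  have hEsymm : Real.exp (-(δ * min ((geomT D).dist ⟨q, hqD⟩ ⟨p, hpD⟩) ((geomT D').dist ⟨q, hqD'⟩ ⟨p, hpD'⟩)))
      * Real.exp (-(δ * dOmega D D' q.2 p.2))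
      = Real.exp (-(δ * min ((geomT D).dist ⟨p, hpD⟩ ⟨q, hqD⟩) ((geomT D').dist ⟨p, hpD'⟩ ⟨q, hqD'⟩)))
        * Real.exp (-(δ * dOmega D D' p.2 q.2)) := by
    rw [symmT D ⟨q, hqD⟩ ⟨p, hpD⟩, symmT D' ⟨q, hqD'⟩ ⟨p, hpD'⟩, dOmega_comm D D' q.2 p.2]
  -- abbreviations
  obtain ⟨E, hE⟩ : ∃ E : ℝ, E = Real.exp (-(δ * min ((geomT D).dist ⟨p, hpD⟩ ⟨q, hqD⟩)
      ((geomT D').dist ⟨p, hpD'⟩ ⟨q, hqD'⟩))) * Real.exp (-(δ * dOmega D D' p.2 q.2)) := ⟨_, rfl⟩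
  have hE0 : 0 ≤ E := by rw [hE]; positivity
  have hL0 : (0 : ℝ) < (ℓ : ℝ) + 1 := by positivity
  -- generic Schur step for a symmetric-type pair `(T, Tᵀ)` bounded at `(p,q)` and `(q,p)`
  have key : ∀ (T : Matrix ↥(boxDom (N0 ℓ Mh k P)) ↥(boxDom (N0 ℓ Mh k P)) ℝ) (Wr Wc : ℝ), 0 ≤ Wr → 0 ≤ Wc →
      Wr * Wc ≤ Wr * Wr →
      (∀ (μ : ↥(boxDom (N0 ℓ Mh k P)) → ℝ) (B : ℝ), BlockSupp (g := geomT D) (blkOf D.toDomains) μ ⟨q, hqD⟩ B →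
        ∀ x, blkOf D.toDomains x = ⟨p, hpD⟩ → |(T *ᵥ μ) x| ≤ Wr * E * B) →
      (∀ (μ : ↥(boxDom (N0 ℓ Mh k P)) → ℝ) (B : ℝ), BlockSupp (g := geomT D) (blkOf D.toDomains) μ ⟨p, hpD⟩ B →
        ∀ z, blkOf D.toDomains z = ⟨q, hqD⟩ → |(Tᵀ *ᵥ μ) z| ≤ Wc * E * B) →
      ∑ x ∈ Finset.univ.filter (fun x => blkOf D.toDomains x = ⟨p, hpD⟩), ((T *ᵥ lam) x) ^ 2
        ≤ (Wr * E) ^ 2 * ∑ z, lam z ^ 2 := by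
    intro T Wr Wc hWr hWc hW hrowB hcolB
    have hWrE : 0 ≤ Wr * E := mul_nonneg hWr hE0
    have hWcE : 0 ≤ Wc * E := mul_nonneg hWc hE0
    have hsum0 : 0 ≤ ∑ z, lam z ^ 2 := Finset.sum_nonneg fun z _ => sq_nonneg _
    have h2 := l2_block_sq_le_of_sums D ⟨p, hpD⟩ ⟨q, hqD⟩ hWrE hWcE
      (fun x hx => row_abs_sum_le_of_bound D x ⟨q, hqD⟩ fun μ B hμ => hrowB μ B hμ x hx)
      (fun z hz => by
        rw [col_sum_eq_row_sum_transpose D T ⟨p, hpD⟩ z]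
        exact row_abs_sum_le_of_bound D z ⟨p, hpD⟩ fun μ B hμ => hcolB μ B hμ z hz) lam hlam
    calc _ ≤ _ := h2
      _ = Wr * Wc * (E * E) * ∑ z, lam z ^ 2 := by ring
      _ ≤ Wr * Wr * (E * E) * ∑ z, lam z ^ 2 :=
          mul_le_mul_of_nonneg_right (mul_le_mul_of_nonneg_right hW (mul_nonneg hE0 hE0)) hsum0
      _ = (Wr * E) ^ 2 * ∑ z, lam z ^ 2 := by ring
  refine ⟨?_, fun μ => ?_, fun μ => ?_, ?_⟩
  · -- `G′[D] − G′[D′]`, symmetric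
    have hT : (gmlT (N0 ℓ Mh k P) ℓ k D.lev a - gmlT (N0 ℓ Mh k P) ℓ k D'.lev a)ᵀ
        = gmlT (N0 ℓ Mh k P) ℓ k D.lev a - gmlT (N0 ℓ Mh k P) ℓ k D'.lev a := by
      rw [Matrix.transpose_sub, gmlT_transpose, gmlT_transpose]
    have hk := key _ (C * ((ℓ : ℝ) + 1) ^ (2 * k)) (C * ((ℓ : ℝ) + 1) ^ (2 * k)) (by positivity) (by positivity)
      le_rfl
      (fun μ B hμ x hx => by
        have h1 := (hpq μ B hμ x hx).1
        rw [hE]; calc _ ≤ _ := h1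
          _ = C₀ * (((ℓ : ℝ) + 1) ^ (2 * k) * (Real.exp (-(δ * min ((geomT D).dist ⟨p, hpD⟩ ⟨q, hqD⟩)
              ((geomT D').dist ⟨p, hpD'⟩ ⟨q, hqD'⟩))) * Real.exp (-(δ * dOmega D D' p.2 q.2))) * B) := by ring
          _ ≤ C * (((ℓ : ℝ) + 1) ^ (2 * k) * (Real.exp (-(δ * min ((geomT D).dist ⟨p, hpD⟩ ⟨q, hqD⟩)
              ((geomT D').dist ⟨p, hpD'⟩ ⟨q, hqD'⟩))) * Real.exp (-(δ * dOmega D D' p.2 q.2))) * B) :=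
            mul_le_mul_of_nonneg_right hC₀1 (by have := hμ.nonneg; positivity)
          _ = _ := by ring)
      (fun μ B hμ z hz => by
        rw [hT]
        have h1 := (hqp μ B hμ z hz).1
        rw [hE, ← hEsymm]
        calc _ ≤ _ := h1
          _ = C₀ * (((ℓ : ℝ) + 1) ^ (2 * k) * (Real.exp (-(δ * min ((geomT D).dist ⟨q, hqD⟩ ⟨p, hpD⟩)
              ((geomT D').dist ⟨q, hqD'⟩ ⟨p, hpD'⟩))) * Real.exp (-(δ * dOmega D D' q.2 p.2))) * B) := by ring
          _ ≤ C * (((ℓ : ℝ) + 1) ^ (2 * k) * (Real.exp (-(δ * min ((geomT D).dist ⟨q, hqD⟩ ⟨p, hpD⟩)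
              ((geomT D').dist ⟨q, hqD'⟩ ⟨p, hpD'⟩))) * Real.exp (-(δ * dOmega D D' q.2 p.2))) * B) :=
            mul_le_mul_of_nonneg_right hC₀1 (by have := hμ.nonneg; positivity)
          _ = _ := by ring)
    rw [hE] at hk
    calc _ ≤ _ := hk
      _ = _ := by ring
  · -- `∇_μ(G′[D] − G′[D′])`, transpose `= (G′[D] − G′[D′])∇_μ*`
    have hT : (dT (N0 ℓ Mh k P) μ * gmlT (N0 ℓ Mh k P) ℓ k D.lev a - dT (N0 ℓ Mh k P) μ * gmlT (N0 ℓ Mh k P) ℓ k D'.lev a)ᵀ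
        = gmlT (N0 ℓ Mh k P) ℓ k D.lev a * (dT (N0 ℓ Mh k P) μ)ᵀ
          - gmlT (N0 ℓ Mh k P) ℓ k D'.lev a * (dT (N0 ℓ Mh k P) μ)ᵀ := by
      rw [Matrix.transpose_sub, Matrix.transpose_mul, Matrix.transpose_mul, gmlT_transpose, gmlT_transpose]
    have hk := key _ (C * ((ℓ : ℝ) + 1) ^ k) (C * ((ℓ : ℝ) + 1) ^ k) (by positivity) (by positivity) le_rfl
      (fun μ' B hμ x hx => by
        have h1 := (hpq μ' B hμ x hx).2.1 μ
        rw [hE]; calc _ ≤ _ := h1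
          _ = C₀ * (((ℓ : ℝ) + 1) ^ k * (Real.exp (-(δ * min ((geomT D).dist ⟨p, hpD⟩ ⟨q, hqD⟩)
              ((geomT D').dist ⟨p, hpD'⟩ ⟨q, hqD'⟩))) * Real.exp (-(δ * dOmega D D' p.2 q.2))) * B) := by ring
          _ ≤ C * (((ℓ : ℝ) + 1) ^ k * (Real.exp (-(δ * min ((geomT D).dist ⟨p, hpD⟩ ⟨q, hqD⟩)
              ((geomT D').dist ⟨p, hpD'⟩ ⟨q, hqD'⟩))) * Real.exp (-(δ * dOmega D D' p.2 q.2))) * B) :=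
            mul_le_mul_of_nonneg_right hC₀1 (by have := hμ.nonneg; positivity)
          _ = _ := by ring)
      (fun μ' B hμ z hz => by
        rw [hT]
        have h1 := (hqp μ' B hμ z hz).2.2.1 μ
        rw [hE, ← hEsymm]
        calc _ ≤ _ := h1
          _ = C₀ * (((ℓ : ℝ) + 1) ^ k * (Real.exp (-(δ * min ((geomT D).dist ⟨q, hqD⟩ ⟨p, hpD⟩)
              ((geomT D').dist ⟨q, hqD'⟩ ⟨p, hpD'⟩))) * Real.exp (-(δ * dOmega D D' q.2 p.2))) * B) := by ring
          _ ≤ C * (((ℓ : ℝ) + 1) ^ k * (Real.exp (-(δ * min ((geomT D).dist ⟨q, hqD⟩ ⟨p, hpD⟩)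
              ((geomT D').dist ⟨q, hqD'⟩ ⟨p, hpD'⟩))) * Real.exp (-(δ * dOmega D D' q.2 p.2))) * B) :=
            mul_le_mul_of_nonneg_right hC₀1 (by have := hμ.nonneg; positivity)
          _ = _ := by ring)
    rw [hE] at hk
    calc _ ≤ _ := hk
      _ = _ := by ring
  · -- `(G′[D] − G′[D′])∇_μ*`, transpose `= ∇_μ(G′[D] − G′[D′])`
    have hT : (gmlT (N0 ℓ Mh k P) ℓ k D.lev a * (dT (N0 ℓ Mh k P) μ)ᵀ
          - gmlT (N0 ℓ Mh k P) ℓ k D'.lev a * (dT (N0 ℓ Mh k P) μ)ᵀ)ᵀ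
        = dT (N0 ℓ Mh k P) μ * gmlT (N0 ℓ Mh k P) ℓ k D.lev a - dT (N0 ℓ Mh k P) μ * gmlT (N0 ℓ Mh k P) ℓ k D'.lev a := by
      rw [Matrix.transpose_sub, Matrix.transpose_mul, Matrix.transpose_mul, Matrix.transpose_transpose,
        gmlT_transpose, gmlT_transpose]
    have hk := key _ (C * ((ℓ : ℝ) + 1) ^ k) (C * ((ℓ : ℝ) + 1) ^ k) (by positivity) (by positivity) le_rfl
      (fun μ' B hμ x hx => by
        have h1 := (hpq μ' B hμ x hx).2.2.1 μ
        rw [hE]; calc _ ≤ _ := h1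
          _ = C₀ * (((ℓ : ℝ) + 1) ^ k * (Real.exp (-(δ * min ((geomT D).dist ⟨p, hpD⟩ ⟨q, hqD⟩)
              ((geomT D').dist ⟨p, hpD'⟩ ⟨q, hqD'⟩))) * Real.exp (-(δ * dOmega D D' p.2 q.2))) * B) := by ring
          _ ≤ C * (((ℓ : ℝ) + 1) ^ k * (Real.exp (-(δ * min ((geomT D).dist ⟨p, hpD⟩ ⟨q, hqD⟩)
              ((geomT D').dist ⟨p, hpD'⟩ ⟨q, hqD'⟩))) * Real.exp (-(δ * dOmega D D' p.2 q.2))) * B) :=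
            mul_le_mul_of_nonneg_right hC₀1 (by have := hμ.nonneg; positivity)
          _ = _ := by ring)
      (fun μ' B hμ z hz => by
        rw [hT]
        have h1 := (hqp μ' B hμ z hz).2.1 μ
        rw [hE, ← hEsymm]
        calc _ ≤ _ := h1
          _ = C₀ * (((ℓ : ℝ) + 1) ^ k * (Real.exp (-(δ * min ((geomT D).dist ⟨q, hqD⟩ ⟨p, hpD⟩)
              ((geomT D').dist ⟨q, hqD'⟩ ⟨p, hpD'⟩))) * Real.exp (-(δ * dOmega D D' q.2 p.2))) * B) := by ring
          _ ≤ C * (((ℓ : ℝ) + 1) ^ k * (Real.exp (-(δ * min ((geomT D).dist ⟨q, hqD⟩ ⟨p, hpD⟩)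
              ((geomT D').dist ⟨q, hqD'⟩ ⟨p, hpD'⟩))) * Real.exp (-(δ * dOmega D D' q.2 p.2))) * B) :=
            mul_le_mul_of_nonneg_right hC₀1 (by have := hμ.nonneg; positivity)
          _ = _ := by ring)
    rw [hE] at hk
    calc _ ≤ _ := hk
      _ = _ := by ring

  · -- `Δ(G′[D] − G′[D′])`: rows `C₀·E`; columns through `(ΔG′)ᵀ = 1 − G′Q′*aQ′` in each family and
    -- `Q′*aQ′[D]μ = Q′*aQ′[D′]μ` on the common top block: `Tᵀμ = −(G′[D] − G′[D′])(Q′*aQ′μ)`, weight `a₊L^{−2k}`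
    obtain ⟨a', ha'0, ha'p, ha'1, ha'eq⟩ := weights_repair ha haw
    have hGD := gmlT_congr D ha'eq
    have hGD' := gmlT_congr D' ha'eq
    have hT : (perLapT (N0 ℓ Mh k P) * gmlT (N0 ℓ Mh k P) ℓ k D.lev a
          - perLapT (N0 ℓ Mh k P) * gmlT (N0 ℓ Mh k P) ℓ k D'.lev a)ᵀ
        = gmlT (N0 ℓ Mh k P) ℓ k D'.lev a' * vOp (N0 ℓ Mh k P) ℓ k D'.lev a'
          - gmlT (N0 ℓ Mh k P) ℓ k D.lev a' * vOp (N0 ℓ Mh k P) ℓ k D.lev a' := by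
      rw [Matrix.transpose_sub, hGD, hGD', transpose_lapGp D hMh1 hP ha'1, transpose_lapGp D' hMh1 hP ha'1]
      abel
    have hLk : (0 : ℝ) < ((ℓ : ℝ) + 1) ^ (2 * k) := by positivity
    have hk := key _ C (C * max aplus aminus / max 1 (max aplus aminus)) hC.le (by positivity)
      (by
        have h1 : max aplus aminus / max 1 (max aplus aminus) ≤ 1 := by
          rw [div_le_one (by positivity)]; exact le_max_right _ _
        calc C * (C * max aplus aminus / max 1 (max aplus aminus))
            = C * C * (max aplus aminus / max 1 (max aplus aminus)) := by ring
          _ ≤ C * C * 1 := mul_le_mul_of_nonneg_left h1 (by positivity)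
          _ = C * C := mul_one _)
      (fun μ B hμ x hx => by
        have h1 := (hpq μ B hμ x hx).2.2.2
        rw [hE]; calc _ ≤ _ := h1
          _ = C₀ * ((Real.exp (-(δ * min ((geomT D).dist ⟨p, hpD⟩ ⟨q, hqD⟩)
              ((geomT D').dist ⟨p, hpD'⟩ ⟨q, hqD'⟩))) * Real.exp (-(δ * dOmega D D' p.2 q.2))) * B) := by ring
          _ ≤ C * ((Real.exp (-(δ * min ((geomT D).dist ⟨p, hpD⟩ ⟨q, hqD⟩)
              ((geomT D').dist ⟨p, hpD'⟩ ⟨q, hqD'⟩))) * Real.exp (-(δ * dOmega D D' p.2 q.2))) * B) :=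
            mul_le_mul_of_nonneg_right hC₀1 (by have := hμ.nonneg; positivity)
          _ = _ := by ring)
      (fun μ B hμ z hz => by
        rw [hT]
        -- `Q′*aQ′μ` is the same vector in both families, supported in `B^k(p)`, of size `a₊L^{−2k}B`
        have hv := vOp_mulVec_blockSupp D (fun j _ => ha'0 j) (fun j _ => ha'p j) hμ
        have hveq := vOp_mulVec_eq_of_top D D' (fun j _ => ha'0 j) (fun j _ => ha'p j) hpD hpD' hp hμ
        have hsub : ((gmlT (N0 ℓ Mh k P) ℓ k D'.lev a' * vOp (N0 ℓ Mh k P) ℓ k D'.lev a'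
              - gmlT (N0 ℓ Mh k P) ℓ k D.lev a' * vOp (N0 ℓ Mh k P) ℓ k D.lev a') *ᵥ μ) z
            = -(((gmlT (N0 ℓ Mh k P) ℓ k D.lev a - gmlT (N0 ℓ Mh k P) ℓ k D'.lev a)
                *ᵥ (vOp (N0 ℓ Mh k P) ℓ k D.lev a' *ᵥ μ)) z) := by
          rw [Matrix.sub_mulVec, Matrix.sub_mulVec, ← Matrix.mulVec_mulVec, ← Matrix.mulVec_mulVec, ← hveq, hGD, hGD']
          simp only [Pi.sub_apply]
          ring
        rw [hsub, abs_neg]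
        have h1 := (hqp _ _ hv z hz).1
        have hpk : (⟨p, hpD⟩ : ↥(bset D.toDomains)).1.1 = k := hp
        rw [hpk] at h1
        rw [hE, ← hEsymm]
        calc _ ≤ _ := h1
          _ = C₀ * max aplus aminus * (((ℓ : ℝ) + 1) ^ (2 * k) * (((ℓ : ℝ) + 1) ^ (2 * k))⁻¹)
              * (Real.exp (-(δ * min ((geomT D).dist ⟨q, hqD⟩ ⟨p, hpD⟩) ((geomT D').dist ⟨q, hqD'⟩ ⟨p, hpD'⟩)))
                * Real.exp (-(δ * dOmega D D' q.2 p.2))) * B := by ring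
          _ = C * max aplus aminus / max 1 (max aplus aminus)
              * (Real.exp (-(δ * min ((geomT D).dist ⟨q, hqD⟩ ⟨p, hpD⟩) ((geomT D').dist ⟨q, hqD'⟩ ⟨p, hpD'⟩)))
                * Real.exp (-(δ * dOmega D D' q.2 p.2))) * B := by
            rw [mul_inv_cancel₀ hLk.ne', mul_one, hCdef]
            field_simp)
    rw [hE] at hk
    calc _ ≤ _ := hk
      _ = _ := by ring

end

end Literature.MathematicalPhysics.QuantumFieldTheory.Balaban1983to89.B9Thm314GpFlatL2
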